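import Summits.ResolutionOfSingularities.ResolutionOfSingularities.Theorems.FrobeniusLadderFInjectiveMacaulayficationSpreadGoodAprimeOf
import HarnessLib

/-!
# Goodness of a GIVEN centre spreads from its stalk: `GoodOver p X₁ J U` on an open `U ∋ ζ` from FULLness of the local blow-up of `J_ζ`
# (crux `FInjectiveMacaulayfication` stmt-ResolutionOfSingularities-15315, chain w45a, HOLE #3 / FC″(loc dim ≤ 3); res-L1-w45a-plan-1 R16.43 (a) /
# R16.44 (1)(i) «lead-1: `goodOver_nhd_of_locGood (hDM) (hCMo)`, file `…GoodOverSpreads.lean`; stub-1 imports it for (c) `exists_dominating_goodOver_nhd`»)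

[OURS · L1 W4.5a · res-L1-w45a-lead-1] Support file (`--supports stmt-ResolutionOfSingularities-15315 --as helper`); NOT a statement of any manuscript;
def-free; CONDITIONAL on `NonFullLocusClosed.NonFullLocusClosed` (= Datta–Murayama 2024 Thm. B + openness of the Cohen–Macaulay locus BY NAME,
`NonFullLocusClosed.nonFullLocusClosed_of_named`); AI-written (AI review is weaker than expert review).

THE POINT.  (T2′) `SpreadLocFix.exists_spread_full_of_locFixData` CONSTRUCTS a centre `J` (the spread of a tuple of germs `c′` at `η`) and shows
that every blowing up along it is FULL over an open `U ∋ η`.  Its proof uses `J` only through `J ≠ ⊥` and `J_η = (c′)`.  Here the centre `J` is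
GIVEN (any non-zero ideal sheaf), `c′` is any tuple generating its stalk `J_ζ`, and the datum is FULLness of the affine blow-up charts
`𝒪_{X₁,ζ}[(c′)/c′_j]` at the primes over `𝔪_ζ` — the fibre over the closed point of `Spec 𝒪_{X₁,ζ}` only: FULLness over the proper
generizations of `ζ` and over a whole neighbourhood FOLLOWS (closed non-FULL locus upstairs + properness of the blow-up), exactly as in (T2′).
This is the brick «a partial cure `J₀` can be tested/improved near a residual point without re-spreading» of plan-1's dominating-local-fix
programme (R16.43): with `J := J₀ · J″` and `J_ζ = J₀,ζ · 𝔟` it turns a product-compatible LOCAL cure into `GoodOver p X₁ (J₀ * J″) U`.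

* `full_nhd_of_locFull (hNF) (J) (hJ0) (ζ) (c′) (hJζ : stalkIdeal J ζ = (c′)) (hfull : charts FULL over 𝔪_ζ) : ∃ U ∋ ζ, every blow-up along J is
  FULL at every point over U`;
* `goodOver_nhd_of_locFull (hNF) … : ∃ U : X₁.Opens, ζ ∈ U ∧ GoodOver p X₁ J U` and `goodOver_nhd_of_locGood (hDM) (hCMo) …` (printed facts BY NAME);
* `goodOver_nhd_of_locFixData (hNF) … (hdat : LocFixData p X₁ ζ n′ c′) (hJζ)` — the `LocFixData`-shaped wrapper.
[cite: DattaMurayama2024, Thm. B] [cite: StacksProject, Tag 0804]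
-/

-- single-problem summit: the doubled namespace component is forced
set_option linter.dupNamespace false

noncomputable section

namespace Summit.ResolutionOfSingularities.ResolutionOfSingularities.Theorems.FInjectiveMacaulayfication.GoodOverSpreads

open CategoryTheory AlgebraicGeometry TopologicalSpace IsLocalRing
open Literature.AlgebraicGeometry.Resolution
open Summit.ResolutionOfSingularities.ResolutionOfSingularities.Theorems.FInjectiveMacaulayfication
open SliceableCentre FCUnguardedAprime

/-- **Every blowing up along a GIVEN `J` is FULL over a neighbourhood of `ζ` as soon as the affine blow-up charts of `J_ζ = (c′)` are FULL at the
primes over `𝔪_ζ`.**  Proof = (T2′)'s: fix ONE blowing up `π : X₂ → X₁` along `J` (`exists_isBlowup`; proper, `X₂` integral); its non-FULL locus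
`Z` is closed (`hNF`), so `B := π(Z)` is closed; `ζ ∉ B` because a point of `X₂` over `ζ` has local ring `(𝒪_ζ[(c′)/c′_j])_𝔔` with `𝔔` over `𝔪_ζ`
(`IsBlowup.exists_blowupAlgebra_stalk_ringEquiv`, Stacks 0804), FULL by the datum; `U := X₁ ∖ B`; any other blowing up along `J` is `X₂` up to an
`X₁`-isomorphism (`IsBlowup.unique`). [OURS · conditional on `NonFullLocusClosed`] [cite: StacksProject, Tag 0804] -/
theorem full_nhd_of_locFull (hNF : NonFullLocusClosed.NonFullLocusClosed)
    (p : ℕ) (hp : p.Prime) (k : Type) [Field k] [CharP k p] (X₁ : Scheme.{0}) (f₁ : X₁ ⟶ Spec (.of k))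
    [LocallyOfFiniteType f₁] [QuasiCompact f₁] [IsIntegral X₁]
    (J : X₁.IdealSheafData) (hJ0 : J ≠ ⊥) (ζ : X₁) (n' : ℕ) (c' : Fin n' → X₁.presheaf.stalk ζ)
    (hJζ : stalkIdeal J ζ = Ideal.span (Set.range c'))
    (hfull : ∀ (j : Fin n') (𝔔 : PrimeSpectrum (blowupAlgebra (Ideal.span (Set.range c')) (c' j))),
      𝔔.asIdeal.comap (algebraMap (X₁.presheaf.stalk ζ) (blowupAlgebra (Ideal.span (Set.range c')) (c' j))) =
        maximalIdeal (X₁.presheaf.stalk ζ) → FullCl p (Localization.AtPrime 𝔔.asIdeal)) :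
    ∃ U : X₁.Opens, ζ ∈ (U : Set X₁) ∧
      ∀ (X₂ : Scheme.{0}) (π : X₂ ⟶ X₁), IsBlowup π J → ∀ x : X₂, π.base x ∈ (U : Set X₁) → FullCl p (X₂.presheaf.stalk x) := by
  classical
  haveI : Fact p.Prime := ⟨hp⟩
  haveI : IsNoetherian X₁ := ClosedPointsOfClosedFinite.isNoetherian_of_locallyOfFiniteType_of_quasiCompact f₁
  -- ONE blowing up along `J`
  obtain ⟨X₂, π, hπ⟩ := exists_isBlowup X₁ J
  haveI : IsProper π := hπ.isProper
  haveI : IsIntegral X₂ := hπ.isIntegral hJ0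
  -- its non-FULL locus `Z` is closed, hence so is `B := π(Z)`
  have hZ : IsClosed {x : X₂ | ¬ NonFullLocusClosed.Clause p (X₂.presheaf.stalk x)} :=
    hNF p hp k X₂ (π ≫ f₁) inferInstance inferInstance inferInstance
  have hBc : IsClosed (π.base '' {x : X₂ | ¬ NonFullLocusClosed.Clause p (X₂.presheaf.stalk x)}) := π.isClosedMap _ hZ
  -- `ζ ∉ B`
  have hζB : ζ ∉ π.base '' {x : X₂ | ¬ NonFullLocusClosed.Clause p (X₂.presheaf.stalk x)} := by
    rintro ⟨x₂, hx₂, hx₂ζ⟩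
    subst hx₂ζ
    obtain ⟨j, 𝔔, χ, e, -, -, -, h𝔔⟩ := hπ.exists_blowupAlgebra_stalk_ringEquiv x₂ c' hJζ.symm
    apply hx₂
    unfold NonFullLocusClosed.Clause
    exact DegreeZeroDescent.inlineClause_of_ringEquiv p e.symm (hfull j 𝔔 h𝔔).2
  refine ⟨⟨_, hBc.isOpen_compl⟩, hζB, ?_⟩
  -- any blowing up along `J` is `X₂` up to an `X₁`-isomorphism, which identifies stalks
  intro X₂' π' hπ' x' hx'
  obtain ⟨e, he, -⟩ := hπ'.unique hπ
  have hx₂ : π.base (e.hom.base x') = π'.base x' := by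
    rw [← Scheme.Hom.comp_apply, he]
  have hgood : NonFullLocusClosed.Clause p (X₂.presheaf.stalk (e.hom.base x')) := by
    by_contra hbad
    exact hx' ⟨e.hom.base x', hbad, hx₂⟩
  unfold NonFullLocusClosed.Clause at hgood
  let ex : X₂.presheaf.stalk (e.hom.base x') ≃+* X₂'.presheaf.stalk x' := (asIso (e.hom.stalkMap x')).commRingCatIsoToRingEquiv
  exact ⟨MulEquiv.isDomain _ ex.symm.toMulEquiv, DegreeZeroDescent.inlineClause_of_ringEquiv p ex hgood⟩

/-- **`GoodOver p X₁ J U` on an open `U ∋ ζ` for a GIVEN centre `J`, from FULLness of the charts of `J_ζ` over `𝔪_ζ`** (FULL at the non-closed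
points over `U`, Cohen–Macaulay at the closed ones — indeed FULL at all of them). [OURS · conditional on `NonFullLocusClosed`] -/
theorem goodOver_nhd_of_locFull (hNF : NonFullLocusClosed.NonFullLocusClosed)
    (p : ℕ) (hp : p.Prime) (k : Type) [Field k] [CharP k p] (X₁ : Scheme.{0}) (f₁ : X₁ ⟶ Spec (.of k))
    [LocallyOfFiniteType f₁] [QuasiCompact f₁] [IsIntegral X₁]
    (J : X₁.IdealSheafData) (hJ0 : J ≠ ⊥) (ζ : X₁) (n' : ℕ) (c' : Fin n' → X₁.presheaf.stalk ζ)
    (hJζ : stalkIdeal J ζ = Ideal.span (Set.range c'))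
    (hfull : ∀ (j : Fin n') (𝔔 : PrimeSpectrum (blowupAlgebra (Ideal.span (Set.range c')) (c' j))),
      𝔔.asIdeal.comap (algebraMap (X₁.presheaf.stalk ζ) (blowupAlgebra (Ideal.span (Set.range c')) (c' j))) =
        maximalIdeal (X₁.presheaf.stalk ζ) → FullCl p (Localization.AtPrime 𝔔.asIdeal)) :
    ∃ U : X₁.Opens, ζ ∈ (U : Set X₁) ∧ GoodOver p X₁ J (U : Set X₁) := by
  obtain ⟨U, hζU, hgood⟩ := full_nhd_of_locFull hNF p hp k X₁ f₁ J hJ0 ζ n' c' hJζ hfull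
  refine ⟨U, hζU, fun X₂ π hπ => ⟨fun x hx _ => hgood X₂ π hπ x hx, fun x hx _ => ?_⟩⟩
  obtain ⟨-, hF⟩ := hgood X₂ π hπ x hx
  exact fun d hd s hs => (hF d hd s hs).1

/-- **`goodOver_nhd_of_locGood` — the same modulo the two printed openness theorems BY NAME** (Datta–Murayama 2024 Thm. B
`DattaMurayama2024_fInjectiveLocusOpen`; openness of the Cohen–Macaulay locus `NonFullLocusClosed.CMLocusOpen`, EGA IV₂ 6.11.2), in the name plan-1
R16.43 (a) gave it. [OURS · conditional-result] [cite: DattaMurayama2024, Thm. B] -/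
theorem goodOver_nhd_of_locGood
    (hDM : Literature.AlgebraicGeometry.Resolution.DattaMurayama2024_fInjectiveLocusOpen.{0})
    (hCMo : NonFullLocusClosed.CMLocusOpen)
    (p : ℕ) (hp : p.Prime) (k : Type) [Field k] [CharP k p] (X₁ : Scheme.{0}) (f₁ : X₁ ⟶ Spec (.of k))
    [LocallyOfFiniteType f₁] [QuasiCompact f₁] [IsIntegral X₁]
    (J : X₁.IdealSheafData) (hJ0 : J ≠ ⊥) (ζ : X₁) (n' : ℕ) (c' : Fin n' → X₁.presheaf.stalk ζ)
    (hJζ : stalkIdeal J ζ = Ideal.span (Set.range c'))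
    (hfull : ∀ (j : Fin n') (𝔔 : PrimeSpectrum (blowupAlgebra (Ideal.span (Set.range c')) (c' j))),
      𝔔.asIdeal.comap (algebraMap (X₁.presheaf.stalk ζ) (blowupAlgebra (Ideal.span (Set.range c')) (c' j))) =
        maximalIdeal (X₁.presheaf.stalk ζ) → FullCl p (Localization.AtPrime 𝔔.asIdeal)) :
    ∃ U : X₁.Opens, ζ ∈ (U : Set X₁) ∧ GoodOver p X₁ J (U : Set X₁) :=
  goodOver_nhd_of_locFull (NonFullLocusClosed.nonFullLocusClosed_of_named hDM hCMo) p hp k X₁ f₁ J hJ0 ζ n' c' hJζ hfull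

/-- **The `LocFixData`-shaped wrapper**: an (A′) LocFix datum `(c′)` at `ζ` which happens to generate the stalk of a GIVEN `J ≠ ⊥` makes `J` good
over a neighbourhood of `ζ` (the conditions `(c′) ≠ ⊥`, `(c′) ≤ 𝔪_ζ` of the datum are idle here). [OURS · conditional on `NonFullLocusClosed`] -/
theorem goodOver_nhd_of_locFixData (hNF : NonFullLocusClosed.NonFullLocusClosed)
    (p : ℕ) (hp : p.Prime) (k : Type) [Field k] [CharP k p] (X₁ : Scheme.{0}) (f₁ : X₁ ⟶ Spec (.of k))
    [LocallyOfFiniteType f₁] [QuasiCompact f₁] [IsIntegral X₁]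
    (J : X₁.IdealSheafData) (hJ0 : J ≠ ⊥) (ζ : X₁) (n' : ℕ) (c' : Fin n' → X₁.presheaf.stalk ζ)
    (hdat : LocFixData p X₁ ζ n' c') (hJζ : stalkIdeal J ζ = Ideal.span (Set.range c')) :
    ∃ U : X₁.Opens, ζ ∈ (U : Set X₁) ∧ GoodOver p X₁ J (U : Set X₁) :=
  goodOver_nhd_of_locFull hNF p hp k X₁ f₁ J hJ0 ζ n' c' hJζ hdat.2.2

end Summit.ResolutionOfSingularities.ResolutionOfSingularities.Theorems.FInjectiveMacaulayfication.GoodOverSpreads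

end
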